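import Literature.Combinatorics.StablePolynomials.BasicProofs
import HarnessLib

/-!
# Stability preservers in kernel form; coefficients of multi-affine polynomials; block specialisation

Companion of `Literature/Combinatorics/StablePolynomials/Basic.lean` (vocabulary
`IsUpperHalfPlaneStable`, `multiAffine`, `IsMultiAffine`, `multiAffineSymbol`) and
`BasicProofs.lean` (Borcea–Brändén 2009, Theorem 1.1 / Lemma 2.2 for multi-affine polynomials,
proved: `multiAffineSymbol_stable_apply_multiAffine`, `multiAffine_stabilityPreserver_sufficiency`).
Requested with the definition item for `IsUpperHalfPlaneStable` by the routes
`AtomisticToContinuum/BoseEinsteinCondensation/BECPolyaSchur` and `…/BECStronglyRayleigh`, whose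
statements (`GroundStateStability`, `StableImpliesPairCoherence`) speak about coefficient families
`φ : Finset Λ → ℂ` and write stability inline as "`Σ_S φ(S) ∏_{x∈S} z_x ≠ 0` whenever all
`Im z_x > 0`", and whose proof plan applies "each bond factor of `e^{-τH}` is a stability preserver"
— a *matrix* acting on such coefficient families.

## Contents (namespace `Literature.Combinatorics.StablePolynomials`)

* **Kernel form of Borcea–Brändén's Lemma 2.2** (`multiAffine_kernel_stable_or_zero`): for a matrix
  `K : Finset σ → Finset σ → ℂ` whose symbol `Σ_S (Σ_{S'} K S' S ∏_{i∈S'} zᵢ) ∏_{i∉S} wᵢ` has no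
  zero with all `Im zᵢ, Im wᵢ > 0`, and a coefficient family `a` with `Σ_S a(S) z^S ≠ 0` on `Hⁿ`,
  the family `(Ka)(S') = Σ_S K S' S a(S)` is identically `0` or again has `Σ (Ka)(S') z^{S'} ≠ 0`
  on `Hⁿ`. Here `kernelOp K` is the linear operator `z^S ↦ Σ_{S'} K S' S z^{S'}` on polynomials
  (`kernelOp_prod_X`, `kernelOp_multiAffine`, `eval_multiAffineSymbol_kernelOp`), and the theorem
  is `multiAffineSymbol_stable_apply_multiAffine` (`BasicProofs.lean`) read through the bridge
  `isUpperHalfPlaneStable_multiAffine_iff` (`Basic.lean`).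
* Coefficients of the coefficient form `multiAffine a = Σ_S a(S) z^S`: `coeff_multiAffine`,
  `coeff_multiAffine_indicator` (`[z^S] = a(S)`), `coeff_multiAffine_eq_zero`,
  `isMultiAffine_multiAffine`, `multiAffine_eq_zero_iff`.
* **Block specialisation at a real point** (`IsUpperHalfPlaneStable.eq_zero_or_setInrZero`): for
  a stable `q(z, w)` in the variables `σ ⊕ τ`, `q(z, 0)` (`setInrZero q`, all `w`-variables set to
  `0` at once) is `0` or stable — the several-variables-at-once form of Borcea–Brändén's
  Lemma 1.7 (1) / Wagner's Lemma 2.4 (d), from `eq_zero_or_isUpperHalfPlaneStable_of_mem_closure`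
  (`Limits.lean`, Hurwitz along complex lines).

## References

* J. Borcea, P. Brändén, *The Lee–Yang and Pólya–Schur programs. I. Linear operators preserving
  stability*, Invent. Math. 177 (2009) 541–569 (arXiv:0809.0401): §1.1 (symbol `G_T`), §1.2
  Lemma 1.7, §2.1 (multi-affine polynomials `f = Σ_S a(S) z^S`; Lemma 2.2). [BorceaBranden2009]
* D. G. Wagner, *Multivariate stable polynomials: theory and applications*, Bull. AMS 48 (2011),
  §2, Lemma 2.4 (d). [Wagner2011]
-/

noncomputable section

open MvPolynomial Finset Filter
open scoped BigOperators Topology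

namespace Literature.Combinatorics.StablePolynomials

variable {σ τ : Type*}

/-! ### Coefficients of the coefficient form `Σ_S a(S) z^S` -/

section Coefficients

variable [Fintype σ] [DecidableEq σ]

omit [Fintype σ] in
/-- Indicator exponent vectors `𝟙_S = Σ_{k ∈ S} e_k` determine the set. [folklore] -/
theorem eq_of_sum_single_one_eq {S S' : Finset σ}
    (h : (∑ k ∈ S, Finsupp.single k 1 : σ →₀ ℕ) = ∑ k ∈ S', Finsupp.single k 1) : S = S' := by
  ext i
  have hi := DFunLike.congr_fun h i
  rw [sum_single_one_apply, sum_single_one_apply] at hi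
  by_cases h1 : i ∈ S <;> by_cases h2 : i ∈ S' <;> simp_all

omit [Fintype σ] in
/-- A `{0,1}`-valued exponent vector is the indicator of its support. [folklore] -/
theorem sum_support_single_one_eq {m : σ →₀ ℕ} (hm : ∀ i, m i ≤ 1) :
    (∑ k ∈ m.support, Finsupp.single k 1 : σ →₀ ℕ) = m := by
  ext i
  rw [sum_single_one_apply]
  by_cases hi : i ∈ m.support
  · rw [if_pos hi]
    have h1 := hm i
    have h2 := Finsupp.mem_support_iff.1 hi
    omega
  · rw [if_neg hi]
    exact (Finsupp.notMem_support_iff.1 hi).symm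

/-- Coefficients of `Σ_S a(S) z^S`. [folklore] -/
theorem coeff_multiAffine (a : Finset σ → ℂ) (m : σ →₀ ℕ) :
    coeff m (multiAffine a) =
      ∑ S : Finset σ, if (∑ i ∈ S, Finsupp.single i 1) = m then a S else 0 := by
  simp only [multiAffine, coeff_sum]
  refine Finset.sum_congr rfl fun S _ => ?_
  rw [prod_X_eq_monomial, C_mul_monomial, mul_one, coeff_monomial]

omit [DecidableEq σ] in
/-- **`[z^S] (Σ_S a(S) z^S) = a(S)`** (Borcea–Brändén 2009, §2.1: `a(S)` is the coefficient of `z^S`).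
[cite: BorceaBranden2009, §2.1] -/
theorem coeff_multiAffine_indicator (a : Finset σ → ℂ) (S : Finset σ) :
    coeff (∑ i ∈ S, Finsupp.single i 1) (multiAffine a) = a S := by
  classical
  rw [coeff_multiAffine, Finset.sum_eq_single S]
  · rw [if_pos rfl]
  · intro S' _ hS'
    rw [if_neg]
    exact fun h => hS' (eq_of_sum_single_one_eq h)
  · exact fun h => absurd (Finset.mem_univ S) h

omit [DecidableEq σ] in
/-- Coefficients of `Σ_S a(S) z^S` at exponents that are not square-free vanish. [folklore] -/
theorem coeff_multiAffine_eq_zero (a : Finset σ → ℂ) {m : σ →₀ ℕ} {i : σ} (hi : 1 < m i) :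
    coeff m (multiAffine a) = 0 := by
  classical
  rw [coeff_multiAffine]
  refine Finset.sum_eq_zero fun S _ => if_neg fun h => ?_
  have := DFunLike.congr_fun h i
  rw [sum_single_one_apply] at this
  split_ifs at this <;> omega

omit [DecidableEq σ] in
/-- The coefficient form `Σ_S a(S) z^S` is multi-affine (Borcea–Brändén 2009, §2.1: "multi-affine
if all monomials in its Taylor expansion are square-free"). [cite: BorceaBranden2009, §2.1] -/
theorem isMultiAffine_multiAffine (a : Finset σ → ℂ) : IsMultiAffine (multiAffine a) := by
  rw [isMultiAffine_iff_support]
  intro m hm i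
  by_contra hi
  exact (mem_support_iff.1 hm) (coeff_multiAffine_eq_zero a (not_le.1 hi))

omit [DecidableEq σ] in
/-- `Σ_S a(S) z^S = 0` iff all `a(S) = 0`. [folklore] -/
theorem multiAffine_eq_zero_iff (a : Finset σ → ℂ) : multiAffine a = 0 ↔ ∀ S, a S = 0 := by
  constructor
  · intro h S
    rw [← coeff_multiAffine_indicator a S, h, coeff_zero]
  · intro h
    simp [multiAffine, h]

end Coefficients

/-! ### Setting a block of variables to zero -/

section SetZero

/-- **Set the second block of variables to zero**: the substitution `w_j := 0` (`j : τ`) on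
polynomials in the variables `σ ⊕ τ` (`z = inl`, `w = inr`), read as a polynomial in the first
block `σ` (`MvPolynomial.bind₁`). [folklore] -/
def setInrZero : MvPolynomial (σ ⊕ τ) ℂ →ₐ[ℂ] MvPolynomial σ ℂ :=
  bind₁ (Sum.elim X fun _ => 0)

/-- Evaluating after `w := 0` is evaluating at `(z, 0)`. [folklore] -/
theorem eval_setInrZero (z : σ → ℂ) (q : MvPolynomial (σ ⊕ τ) ℂ) :
    eval z (setInrZero q) = eval (Sum.elim z fun _ => 0) q := by
  rw [setInrZero, eval_bind₁]
  have : (fun x : σ ⊕ τ => eval z (Sum.elim X (fun _ => (0 : MvPolynomial σ ℂ)) x)) =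
      Sum.elim z fun _ : τ => 0 := by
    funext x
    cases x <;> simp
  rw [this]

/-- `w := 0` does nothing to a polynomial in the `z`-variables. [folklore] -/
@[simp] theorem setInrZero_rename_inl (t : MvPolynomial σ ℂ) :
    setInrZero (rename Sum.inl t : MvPolynomial (σ ⊕ τ) ℂ) = t := by
  rw [setInrZero, bind₁_rename, Sum.elim_comp_inl, bind₁_X_left, AlgHom.id_apply]

/-- `w := 0` on constants. [folklore] -/
@[simp] theorem setInrZero_C (c : ℂ) : setInrZero (C c : MvPolynomial (σ ⊕ τ) ℂ) = C c :=
  bind₁_C_right _ _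

/-- `w := 0` on a `z`-variable. [folklore] -/
@[simp] theorem setInrZero_X_inl (i : σ) : setInrZero (X (Sum.inl i) : MvPolynomial (σ ⊕ τ) ℂ) = X i :=
  bind₁_X_right _ _

/-- `w := 0` on a `w`-variable. [folklore] -/
@[simp] theorem setInrZero_X_inr (j : τ) : setInrZero (X (Sum.inr j) : MvPolynomial (σ ⊕ τ) ℂ) = 0 :=
  bind₁_X_right _ _

/-- `w := 0` kills every monomial containing some `w_j`. [folklore] -/
theorem setInrZero_monomial_eq_zero {s : σ ⊕ τ →₀ ℕ} {j : τ} (hj : s (Sum.inr j) ≠ 0) (a : ℂ) :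
    setInrZero (monomial s a) = 0 := by
  rw [setInrZero, bind₁_monomial]
  refine mul_eq_zero_of_right _ (Finset.prod_eq_zero (Finsupp.mem_support_iff.2 hj) ?_)
  simp [zero_pow hj]

/-- **Real specialisation of a block of variables preserves "stable or zero"**: if `q(z, w)` is
stable then `q(z, 0)` is `0` or stable — the real point `w = 0` lies in the closure of `H^τ`, so
this is the limit case of specialisation inside `H` (Borcea–Brändén 2009, Lemma 1.7 (1), one
variable at a time; Wagner 2011, Lemma 2.4 (d)), obtained here for the whole block at once from
`eq_zero_or_isUpperHalfPlaneStable_of_mem_closure` (Hurwitz along complex lines).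
[cite: BorceaBranden2009, §1.2, Lemma 1.7 (1)] -/
theorem IsUpperHalfPlaneStable.eq_zero_or_setInrZero [Finite σ] {q : MvPolynomial (σ ⊕ τ) ℂ}
    (hq : IsUpperHalfPlaneStable q) :
    setInrZero q = 0 ∨ IsUpperHalfPlaneStable (setInrZero q) := by
  let P : (τ → ℂ) → MvPolynomial σ ℂ := fun a => bind₁ (Sum.elim X fun j => C (a j)) q
  have hPe : ∀ (a : τ → ℂ) (z : σ → ℂ), eval z (P a) = eval (Sum.elim z a) q := by
    intro a z
    simp only [P, eval_bind₁]
    have : (fun x : σ ⊕ τ => eval z (Sum.elim X (fun j => C (a j)) x)) = Sum.elim z a := by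
      funext x
      cases x <;> simp
    rw [this]
  have hP : Continuous fun az : (τ → ℂ) × (σ → ℂ) => eval az.2 (P az.1) := by
    simp only [hPe]
    refine (MvPolynomial.continuous_eval (p := q)).comp (continuous_pi fun x => ?_)
    cases x with
    | inl i => exact (continuous_apply i).comp continuous_snd
    | inr j => exact (continuous_apply j).comp continuous_fst
  have hs : ∀ a ∈ {a : τ → ℂ | ∀ j, 0 < (a j).im}, IsUpperHalfPlaneStable (P a) := by
    intro a ha z hz
    rw [hPe]
    rw [Set.mem_setOf_eq] at ha
    refine hq _ fun x => ?_
    cases x with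
    | inl i => simpa using hz i
    | inr j => simpa using ha j
  have hcl : (fun _ : τ => (0 : ℂ)) ∈ closure {a : τ → ℂ | ∀ j, 0 < (a j).im} := by
    refine mem_closure_of_tendsto (f := fun ε : ℝ => fun _ : τ => (ε : ℂ) * Complex.I)
      (b := 𝓝[Set.Ioi 0] (0 : ℝ)) ?_ ?_
    · have hc : Continuous fun ε : ℝ => fun _ : τ => (ε : ℂ) * Complex.I :=
        continuous_pi fun _ => Complex.continuous_ofReal.mul continuous_const
      have := (hc.tendsto 0).mono_left (nhdsWithin_le_nhds (s := Set.Ioi (0 : ℝ)))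
      simpa using this
    · refine eventually_nhdsWithin_of_forall fun ε hε => ?_
      simp only [Set.mem_setOf_eq, Set.mem_Ioi] at hε ⊢
      intro j
      simpa using hε
  have key := eq_zero_or_isUpperHalfPlaneStable_of_mem_closure hP hs hcl
  have hP0 : P (fun _ => 0) = setInrZero q := by
    simp only [P, map_zero]
    rfl
  rwa [hP0] at key

end SetZero

/-! ### Stability preservers given by a matrix on square-free monomials -/

section Kernel

variable [Fintype σ] [DecidableEq σ]

/-- The linear operator with matrix `K` on square-free monomials: `T_K(z^S) = Σ_{S'} K S' S · z^{S'}`,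
extended to all polynomials through their square-free coefficients
(`T_K(p) = Σ_S [z^S]p · T_K(z^S)`); on multi-affine polynomials this is the general linear operator
`ℂ_{(1ⁿ)}[z] → ℂ_{(1ⁿ)}[z]` of Borcea–Brändén 2009, §2.1, written in the monomial basis `(z^S)_S`.
[cite: BorceaBranden2009, §2.1 (linear operators on multi-affine polynomials)] -/
def kernelOp (K : Finset σ → Finset σ → ℂ) : MvPolynomial σ ℂ →ₗ[ℂ] MvPolynomial σ ℂ :=
  ∑ S : Finset σ, (lcoeff ℂ (∑ i ∈ S, Finsupp.single i 1)).smulRight (multiAffine fun S' => K S' S)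

omit [DecidableEq σ] in
/-- Unfolding `kernelOp`. [folklore] -/
theorem kernelOp_apply (K : Finset σ → Finset σ → ℂ) (p : MvPolynomial σ ℂ) :
    kernelOp K p = ∑ S : Finset σ,
      coeff (∑ i ∈ S, Finsupp.single i 1) p • multiAffine (fun S' => K S' S) := by
  simp only [kernelOp, LinearMap.sum_apply, LinearMap.smulRight_apply, lcoeff_apply]

omit [Fintype σ] in
/-- Square-free coefficients of a square-free monomial: `[z^{S''}] z^S = [S'' = S]`. [folklore] -/
theorem coeff_indicator_prod_X (S S'' : Finset σ) :
    coeff (∑ i ∈ S'', Finsupp.single i 1) (∏ i ∈ S, X i : MvPolynomial σ ℂ) =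
      if S'' = S then 1 else 0 := by
  rw [prod_X_eq_monomial, coeff_monomial]
  by_cases h : S'' = S
  · subst h
    rw [if_pos rfl, if_pos rfl]
  · rw [if_neg h, if_neg]
    exact fun e => h (eq_of_sum_single_one_eq e).symm

/-- `T_K` on a square-free monomial: `T_K(z^S) = Σ_{S'} K S' S z^{S'}`. [folklore] -/
theorem kernelOp_prod_X (K : Finset σ → Finset σ → ℂ) (S : Finset σ) :
    kernelOp K (∏ i ∈ S, X i) = multiAffine (fun S' => K S' S) := by
  rw [kernelOp_apply, Finset.sum_eq_single S]
  · rw [coeff_indicator_prod_X, if_pos rfl, one_smul]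
  · intro S'' _ hne
    rw [coeff_indicator_prod_X, if_neg hne, zero_smul]
  · exact fun h => absurd (Finset.mem_univ S) h

omit [DecidableEq σ] in
/-- `T_K` on a coefficient form is matrix-times-vector on the coefficients:
`T_K(Σ_S a(S) z^S) = Σ_{S'} (Σ_S K S' S a(S)) z^{S'}`. [folklore] -/
theorem kernelOp_multiAffine (K : Finset σ → Finset σ → ℂ) (a : Finset σ → ℂ) :
    kernelOp K (multiAffine a) = multiAffine (fun S' => ∑ S, K S' S * a S) := by
  rw [kernelOp_apply]
  simp only [coeff_multiAffine_indicator]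
  simp only [multiAffine, Finset.smul_sum, map_sum, Finset.sum_mul, smul_eq_C_mul]
  rw [Finset.sum_comm]
  refine Finset.sum_congr rfl fun S' _ => Finset.sum_congr rfl fun S _ => ?_
  rw [← mul_assoc, ← map_mul, mul_comm (a S)]

/-- On multi-affine polynomials every linear operator is a `kernelOp`: if `T(z^S) = T_K(z^S)` for
all `S` then `T f = T_K f` for multi-affine `f`. [folklore] -/
theorem eq_kernelOp_of_isMultiAffine (T : MvPolynomial σ ℂ →ₗ[ℂ] MvPolynomial σ ℂ)
    (K : Finset σ → Finset σ → ℂ) (hK : ∀ S, T (∏ i ∈ S, X i) = multiAffine (fun S' => K S' S))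
    {f : MvPolynomial σ ℂ} (hf : IsMultiAffine f) : T f = kernelOp K f := by
  rw [eq_multiAffine_of_isMultiAffine hf]
  simp only [multiAffine, map_sum, C_mul', map_smul, hK, kernelOp_prod_X]

/-- **The symbol of `T_K`, evaluated**: `G_{T_K}(z,w) = Σ_S (Σ_{S'} K S' S z^{S'}) w^{[n]∖S}`.
[cite: BorceaBranden2009, §2.1, Lemma 2.2 (formula for G_T)] -/
theorem eval_multiAffineSymbol_kernelOp (K : Finset σ → Finset σ → ℂ) (zw : σ ⊕ σ → ℂ) :
    eval zw (multiAffineSymbol (kernelOp K)) =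
      ∑ S : Finset σ, (∑ S' : Finset σ, K S' S * ∏ i ∈ S', zw (Sum.inl i)) *
        ∏ i ∈ Sᶜ, zw (Sum.inr i) := by
  simp only [multiAffineSymbol, kernelOp_prod_X, map_sum, map_mul, eval_rename, map_prod, eval_X,
    eval_multiAffine, Function.comp_apply]

/-- `T_K` preserves stability when its symbol is stable (Borcea–Brändén 2009, Lemma 2.2, for the
operator `kernelOp K`; from `multiAffineSymbol_stable_apply_multiAffine`).
[cite: BorceaBranden2009, §2.1, Lemma 2.2] -/
theorem kernelOp_multiAffine_stable_or_zero (K : Finset σ → Finset σ → ℂ)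
    (hK : IsUpperHalfPlaneStable (multiAffineSymbol (kernelOp K))) {a : Finset σ → ℂ}
    (ha : IsUpperHalfPlaneStable (multiAffine a)) :
    IsUpperHalfPlaneStable (multiAffine fun S' => ∑ S, K S' S * a S) ∨
      (fun S' => ∑ S, K S' S * a S) = 0 := by
  rcases multiAffineSymbol_stable_apply_multiAffine (kernelOp K) hK ha with h | h
  · exact Or.inl (by rwa [kernelOp_multiAffine] at h)
  · refine Or.inr (funext fun S' => ?_)
    rw [kernelOp_multiAffine, multiAffine_eq_zero_iff] at h
    exact h S'

/-- **Borcea–Brändén's Lemma 2.2 in kernel / function form** (the shape used by the route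
statements, which write stability of `Σ_S φ(S) z^S` inline). Let `K` be a matrix indexed by the
subsets of `σ` and suppose its symbol `Σ_S (Σ_{S'} K S' S ∏_{i∈S'} zᵢ) ∏_{i∉S} wᵢ` does not vanish
when all `Im zᵢ > 0` and all `Im wᵢ > 0`. If `Σ_S a(S) ∏_{i∈S} zᵢ ≠ 0` whenever all `Im zᵢ > 0`,
then the transformed coefficients `(Ka)(S') = Σ_S K S' S a(S)` are either all `0`, or again
`Σ_{S'} (Ka)(S') ∏_{i∈S'} zᵢ ≠ 0` whenever all `Im zᵢ > 0`.
[cite: BorceaBranden2009, §2.1, Lemma 2.2] -/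
theorem multiAffine_kernel_stable_or_zero (K : Finset σ → Finset σ → ℂ)
    (hK : ∀ z w : σ → ℂ, (∀ i, 0 < (z i).im) → (∀ i, 0 < (w i).im) →
      (∑ S : Finset σ, (∑ S' : Finset σ, K S' S * ∏ i ∈ S', z i) * ∏ i ∈ Sᶜ, w i) ≠ 0)
    {a : Finset σ → ℂ} (ha : ∀ z : σ → ℂ, (∀ i, 0 < (z i).im) → (∑ S, a S * ∏ i ∈ S, z i) ≠ 0) :
    (∀ S', ∑ S, K S' S * a S = 0) ∨
      ∀ z : σ → ℂ, (∀ i, 0 < (z i).im) → (∑ S', (∑ S, K S' S * a S) * ∏ i ∈ S', z i) ≠ 0 := by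
  have hT : IsUpperHalfPlaneStable (multiAffineSymbol (kernelOp K)) := fun zw hzw => by
    rw [eval_multiAffineSymbol_kernelOp]
    exact hK _ _ (fun i => hzw _) (fun i => hzw _)
  have hs : IsUpperHalfPlaneStable (multiAffine a) := (isUpperHalfPlaneStable_multiAffine_iff a).2 ha
  rcases kernelOp_multiAffine_stable_or_zero K hT hs with h | h
  · exact Or.inr ((isUpperHalfPlaneStable_multiAffine_iff _).1 h)
  · exact Or.inl fun S' => congrFun h S'

end Kernel

end Literature.Combinatorics.StablePolynomials

end
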